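import Summits.BirchSwinnertonDyer.Rank1Residual.P2.CongruentNumberSilentEvenFiveEnclosureReduced
import Literature.NumberTheory.EllipticCurves.Tian2014.CMPointSystemPrincipalGenus
import HarnessLib

/-!
# Cell `bsd-monsky` (typer), route A: C-P2-1 on `𝒮⁻` from the BASE aut system display ALONE — the offered corner
# (`…_of_autSystemCore_descent (hSys⁹)`, OFFER-M v1.11) with Tian's principal-genus sentence struck as well

HONEST FRAMING (cell `bsd-monsky`, run/shared/lean/pub/bsd-monsky/; README §1): ONE theorem on ONE explicit infinite
family of quadratic twists of the congruent number curve at the prime `2`; not "BSD for rank ≤ 1", nothing at odd primes;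
nothing is booked by this file. The corner of record of route A (referee B ROUND 742, 2026-08-27T12:40Z) is
`congruentSilentEvenFiveBSDTwo_of_autSystemReduced_descent (hSys⁸)`; the corner offered in OFFER-M v1.11 is
`congruentSilentEvenFiveBSDTwo_of_autSystemCore_descent (hSys⁹)`. A second derivability pass over the displayed hypothesis
(`Literature/…/Tian2014/CMPointSystemPrincipalGenus.lean`) found one more displayed sentence that is a kernel consequence of
the others on `𝒮⁻`: Tian's Notations (ii) «`2𝒜 ≃ Gal(H/H₀)`, i.e. `t ∈ 2𝒜` iff `σ_t` fixes all `√p*_j`» — Gauss's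
principal-genus theorem for `K = ℚ(√−2pq)`, a theorem of the ambiguous-class listing (i), the genus-character values
(iii) and the finiteness of the class group — and proved it; `tian2014_system_sMinus_autBase` (`hSys¹⁰`) is `hSys⁹`
without that sentence, and the two facts are EQUIVALENT in the kernel (`tian2014_system_sMinus_autCore_iff_autBase`).
This file is the corner on the base display: `congruentSilentEvenFiveBSDTwo_of_autSystemBase_descent (hSys¹⁰ :
tian2014_system_sMinus_autBase)` — the `2`-Selmer input the tree's complete `2`-descent (`#Sel⁽²⁾(E_{2pq}/ℚ) ≤ 8`,
p480559), rank one the tree's first `2`-descent (p457453 / p458378) — with the rank axis, clause (a) and both typed forms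
from the same binder (proofs: one-line compositions of the corner of record A⁸-desc / its rank rows, p530835, with
`tian2014_system_sMinus_autReduced_of_autCore ∘ tian2014_system_sMinus_autCore_of_autBase`; the A⁹-desc door p534546 is not
imported). Marks of record untouched (the readings P `tyzPhiParam` and M5 `tyzZN` sit inside `GrossZagierAut`, displayed
verbatim as before). CONDITIONAL on the one (base) system display; nothing asserted; the conjecture `Prop`s stay
`@[conjecture]`.
[cite: Tian2014, Thm. 2.8 (J132), Def. 2.7, Prop. 2.1, p0003 L3–L5 (J119), J124–J126, §4.2 (p0022 L52–L60), Notations (i)–(iii) (J122 L41–54), Prop. 4.6 proof (p0023 L26–L28)]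
[cite: TianYuanZhang2017, Thm. 3.3 (p. 739), p. 749, J733, J741, J747, J751, Lemma 3.16 (J754)]
[cite: SilvermanAEC2009, Prop. X.1.4, Prop. X.4.9, Thm. X.4.2] [cite: Miller2011LMS, Def. 1.1 (arXiv:1010.2431 p. 3)]
[cite: Lagrange1975, §11 table p. 16-12]
-/

noncomputable section

open scoped Classical

open WeierstrassCurve Literature.NumberTheory.EllipticCurves
  Literature.NumberTheory.EllipticCurves.Rank1Residual.Typed

set_option autoImplicit false

namespace Summit.BirchSwinnertonDyer.Rank1Residual.P2

open Conjectures Literature.NumberTheory.EllipticCurves.Tian2014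

/-! ## §1 C-P2-1 on `𝒮⁻` from the base aut display ALONE -/

/-- **C-P2-1 = Theorem 1.1 on `𝒮⁻` from the BASE aut system display `hSys¹⁰` ALONE** — the offered corner
(`…_of_autSystemCore_descent (hSys⁹)`, OFFER-M v1.11) with Tian's principal-genus sentence (ii) struck from the displayed
hypothesis as well (it is a kernel theorem of Notations (i), (iii) and the finiteness of the class group on `𝒮⁻`); the
`2`-Selmer input is the tree's complete `2`-descent. CONDITIONAL on the one base system display; nothing asserted.
[cite: Tian2014, Thm. 2.8 (J132), Def. 2.7, Prop. 2.1, p0003 L3–L5 (J119), J124–J126, Notations (i)–(iii) (J122 L41–54), Prop. 4.6 proof (p0023 L26–L28)]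
[cite: TianYuanZhang2017, Thm. 3.3 (p. 739), p. 749, J733, J741, J747, J751, Lemma 3.16 (J754)]
[cite: SilvermanAEC2009, Prop. X.1.4, Prop. X.4.9, Thm. X.4.2] [cite: Miller2011LMS, Def. 1.1 (arXiv:1010.2431 p. 3)] -/
theorem congruentSilentEvenFiveBSDTwo_of_autSystemBase_descent (hSys : tian2014_system_sMinus_autBase) :
    CongruentSilentEvenFiveBSDTwo :=
  congruentSilentEvenFiveBSDTwo_of_autSystemReduced_descent
    (tian2014_system_sMinus_autReduced_of_autCore (tian2014_system_sMinus_autCore_of_autBase hSys))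

/-! ## §2 The rank axis and the sharper form from the base aut display ALONE -/

/-- **C-P2-1, SHARPER (`Ш_an`-unit) FORM, from the base aut system display ALONE** (`hSys¹⁰`): clause (a) and
`#Ш_an(E_{2pq})` a `2`-adic unit on all of `𝒮⁻` with NO `2`-Selmer input (the first `2`-descent of Lagrange 1975 in the
kernel and the system's own point). CONDITIONAL; nothing asserted.
[cite: Tian2014, Def. 2.7, Prop. 2.1, p0003 L3–L5 (J119), J124–J126, Notations (i)–(iii) (J122 L41–54)]
[cite: TianYuanZhang2017, Thm. 3.3, J733, J741, J747, J751, Lemma 3.16 (J754)] [cite: Lagrange1975, §11 table p. 16-12] -/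
theorem congruentSilentEvenFiveOrdTwo_of_autSystemBase_rankDescent (hSys : tian2014_system_sMinus_autBase) :
    CongruentSilentEvenFiveOrdTwo :=
  congruentSilentEvenFiveOrdTwo_of_autSystemReduced_rankDescent
    (tian2014_system_sMinus_autReduced_of_autCore (tian2014_system_sMinus_autCore_of_autBase hSys))

/-- **Clause (a) on all of `𝒮⁻` from the base aut system display alone**: `ord_{s=1} L(E_{2pq}, s) = 1`.
[cite: TianYuanZhang2017, Thm. 1.1, Thm. 3.3] [cite: Tian2014, Notations (i)–(iii) (J122 L41–54)] [cite: Lagrange1975, §11 table p. 16-12] -/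
theorem analyticRank_eq_one_of_autSystemBase_rankDescent (hSys : tian2014_system_sMinus_autBase) :
    ∀ p q : ℕ, p.Prime → q.Prime → p % 8 = 5 → q % 4 = 3 → jacobiSym p q = -1 →
      (congruentNumberCurve (2 * (p * q))).analyticRank = 1 :=
  analyticRank_eq_one_of_autSystemReduced_rankDescent
    (tian2014_system_sMinus_autReduced_of_autCore (tian2014_system_sMinus_autCore_of_autBase hSys))

/-- **Rank one on all of `𝒮⁻` from the base aut system display alone.** [cite: Lagrange1975, §11 table p. 16-12]
[cite: Monsky1990MockHeegner, Thm. 5.5 (p. 62), Thm. 5.9 (1) (pp. 63–64)] [cite: Tian2014, Notations (i)–(iii) (J122 L41–54)] -/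
theorem mordellWeilRank_eq_one_of_autSystemBase_rankDescent (hSys : tian2014_system_sMinus_autBase) :
    ∀ p q : ℕ, p.Prime → q.Prime → p % 8 = 5 → q % 4 = 3 → jacobiSym p q = -1 →
      (congruentNumberCurve (2 * (p * q))).mordellWeilRank = 1 :=
  mordellWeilRank_eq_one_of_autSystemReduced_rankDescent
    (tian2014_system_sMinus_autReduced_of_autCore (tian2014_system_sMinus_autCore_of_autBase hSys))

/-- **Both typed forms of C-P2-1 on `𝒮⁻` from the base aut display ALONE.** CONDITIONAL; nothing asserted.
[cite: Tian2014, Def. 2.7, Prop. 2.1, p0003 L3–L5 (J119), J124–J126, Notations (i)–(iii) (J122 L41–54)]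
[cite: TianYuanZhang2017, Thm. 3.3, J733, J741, J747, J751, Lemma 3.16 (J754)]
[cite: SilvermanAEC2009, Prop. X.1.4, Prop. X.4.9] [cite: Miller2011LMS, Def. 1.1] -/
theorem congruentSilentEvenFive_pair_of_autSystemBase_descent (hSys : tian2014_system_sMinus_autBase) :
    CongruentSilentEvenFiveOrdTwo ∧ CongruentSilentEvenFiveBSDTwo :=
  ⟨congruentSilentEvenFiveOrdTwo_of_autSystemBase_rankDescent hSys,
    congruentSilentEvenFiveBSDTwo_of_autSystemBase_descent hSys⟩

/-! ## §3 The two corners are interchangeable (the displayed facts are equivalent in the kernel) -/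

/-- **The core corner and the base corner are the same theorem read through equivalent displays**: C-P2-1 follows from
`hSys⁹` iff it follows from `hSys¹⁰`, because `hSys⁹ ⟺ hSys¹⁰` (`tian2014_system_sMinus_autCore_iff_autBase`).
[cite: Tian2014, Notations (i)–(iii) (J122 L41–54)] -/
theorem autSystemCore_imp_bsdTwo_iff_autSystemBase_imp_bsdTwo :
    (tian2014_system_sMinus_autCore → CongruentSilentEvenFiveBSDTwo) ↔
      (tian2014_system_sMinus_autBase → CongruentSilentEvenFiveBSDTwo) :=
  ⟨fun h hB => h (tian2014_system_sMinus_autCore_of_autBase hB),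
    fun h hC => h (tian2014_system_sMinus_autBase_of_autCore hC)⟩

end Summit.BirchSwinnertonDyer.Rank1Residual.P2

end
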